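import Mathlib

/-!
# GaugeDescent, support item `TorusOrbitDescent` (stmt-ValiantsHypothesis-6635) — the image of a
# homomorphism of split tori

Route `GaugeDescent` of `ValiantsHypothesis`, support item `TorusOrbitDescent`. The orbit criterion
used by the descent: for the diagonal action of `(ℂˣ)^k` on `ℂ^n` through an integer matrix `A`,
`z ∈ (ℂˣ)^n` lies in the image of `t ↦ (∏_l t_l^{A_{lv}})_v` iff every Laurent monomial
`∏_v z_v^{u_v}` with `A u = 0` equals `1` (`exists_torus_preimage`; the "only if" half is
`GaugeDescentTorusOrbitDescentPrelims.prod_zpow_torusAct`). Equivalently: the image of a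
homomorphism of split tori over an algebraically closed field is the common kernel of the characters
vanishing on it. Proof: characters form the `ℤ`-linear map `ψ : ℤ^n → ℤ^k`, `u ↦ A u`; the
character `ζ : u ↦ ∏ z^u` kills `ker ψ`, so it factors through `range ψ ≤ ℤ^k`; a Smith normal form
basis of `range ψ` (Mathlib `Submodule.smithNormalForm`) and roots of unity order `a_i` in `ℂˣ`
(`IsAlgClosed.exists_pow_nat_eq`) extend it to `ℤ^k → ℂˣ`, i.e. to `t`. Works over any
algebraically closed field. Honest framing: bookkeeping inside a dormant route whose crux is open;
nothing here bears on VP ≠ VNP.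
-/

-- the summit and the problem share the name `ValiantsHypothesis` (D-0017 single-conjunct layout)
set_option linter.dupNamespace false

namespace Summit.ValiantsHypothesis.ValiantsHypothesis.Theorems.GaugeDescent

variable {K : Type*} [Field K] [IsAlgClosed K]

/-- In an algebraically closed field every unit has an `a`-th root for every integer `a ≠ 0`. -/
theorem exists_zpow_eq_of_ne_zero (x : Kˣ) {a : ℤ} (ha : a ≠ 0) : ∃ y : Kˣ, y ^ a = x := by
  have hn : 0 < a.natAbs := Int.natAbs_pos.mpr ha
  obtain ⟨c, hc⟩ := IsAlgClosed.exists_pow_nat_eq (x : K) hn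
  have hc0 : c ≠ 0 := by
    rintro rfl
    rw [zero_pow hn.ne'] at hc
    exact x.ne_zero hc.symm
  set y₀ : Kˣ := Units.mk0 c hc0 with hy₀
  have hy₀n : y₀ ^ a.natAbs = x := by
    ext; rw [Units.val_pow_eq_pow_val, hy₀, Units.val_mk0, hc]
  rcases Int.natAbs_eq a with h | h
  · refine ⟨y₀, ?_⟩
    rw [h, zpow_natCast, hy₀n]
  · refine ⟨y₀⁻¹, ?_⟩
    rw [h, zpow_neg, inv_zpow, inv_inv, zpow_natCast, hy₀n]

/-- **Image of a homomorphism of split tori = common kernel of the characters vanishing on it.**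
If `z ∈ (Kˣ)^n` satisfies `∏_v z_v^{u_v} = 1` for every `u ∈ ℤ^n` with `∑_v A_{lv} u_v = 0` for all
`l`, then `z_v = ∏_l t_l^{A_{lv}}` for some `t ∈ (Kˣ)^k` (`K` algebraically closed). -/
theorem exists_torus_preimage {κ ι : Type*} [Fintype κ] [DecidableEq κ] [Fintype ι]
    [DecidableEq ι] (A : κ → ι → ℤ) (z : ι → Kˣ)
    (hz : ∀ u : ι → ℤ, (∀ l, ∑ v, A l v * u v = 0) → ∏ v, z v ^ u v = 1) :
    ∃ t : κ → Kˣ, ∀ v, z v = ∏ l, t l ^ A l v := by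
  classical
  -- characters: `ψ u = A u`, `ζ u = ∏ z^u` (additively)
  set ψ : (ι → ℤ) →ₗ[ℤ] (κ → ℤ) := Matrix.mulVecLin (Matrix.of A) with hψ
  have hψapply : ∀ (u : ι → ℤ) (l : κ), ψ u l = ∑ v, A l v * u v := by
    intro u l; rfl
  set ζ₀ : (ι → ℤ) →+ Additive Kˣ :=
    { toFun := fun u => Additive.ofMul (∏ v, z v ^ u v)
      map_zero' := by simp
      map_add' := fun u u' => by
        rw [← ofMul_mul, ← Finset.prod_mul_distrib]
        congr 1
        exact Finset.prod_congr rfl fun v _ => by rw [Pi.add_apply, zpow_add] } with hζ₀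
  set ζ : (ι → ℤ) →ₗ[ℤ] Additive Kˣ := ζ₀.toIntLinearMap with hζ
  have hζapply : ∀ u, ζ u = Additive.ofMul (∏ v, z v ^ u v) := fun u => rfl
  have hker : LinearMap.ker ψ ≤ LinearMap.ker ζ := by
    intro u hu
    rw [LinearMap.mem_ker] at hu ⊢
    rw [hζapply, hz u fun l => by rw [← hψapply, hu]; rfl, ofMul_one]
  -- factor `ζ` through `range ψ`
  set Nr := LinearMap.range ψ with hNr
  set ζbar : Nr →ₗ[ℤ] Additive Kˣ :=
    ((LinearMap.ker ψ).liftQ ζ hker).comp ψ.quotKerEquivRange.symm.toLinearMap with hζbar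
  have hζbar_apply : ∀ u : ι → ℤ, ζbar ⟨ψ u, LinearMap.mem_range_self ψ u⟩ = ζ u := by
    intro u
    rw [hζbar, LinearMap.comp_apply, LinearEquiv.coe_toLinearMap,
      LinearMap.quotKerEquivRange_symm_apply_image, Submodule.mkQ_apply, Submodule.liftQ_apply]
  -- Smith normal form of `range ψ ≤ ℤ^k`
  obtain ⟨r, snf⟩ := Submodule.smithNormalForm (Pi.basisFun ℤ κ) Nr
  have ha : ∀ i, snf.a i ≠ 0 := by
    intro i h0
    have h := snf.snf i
    rw [h0, zero_smul] at h
    exact snf.bN.ne_zero i (Subtype.ext h)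
  -- roots: `a i • w i = ζbar (bN i)`
  have hw : ∀ i, ∃ w : Additive Kˣ, snf.a i • w = ζbar (snf.bN i) := by
    intro i
    obtain ⟨y, hy⟩ := exists_zpow_eq_of_ne_zero (Additive.toMul (ζbar (snf.bN i))) (ha i)
    refine ⟨Additive.ofMul y, ?_⟩
    rw [← ofMul_zpow, hy, ofMul_toMul]
  choose w hw using hw
  -- extend to `τ : ℤ^k → Kˣ`
  set g : κ → Additive Kˣ := fun j => if h : ∃ i, snf.f i = j then w h.choose else 0 with hg
  set τ : (κ → ℤ) →ₗ[ℤ] Additive Kˣ := snf.bM.constr ℤ g with hτ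
  have hgf : ∀ i, g (snf.f i) = w i := by
    intro i
    have h : ∃ i', snf.f i' = snf.f i := ⟨i, rfl⟩
    rw [hg]; simp only [dif_pos h]
    congr 1
    exact snf.f.injective h.choose_spec
  have hτN : ∀ x : Nr, τ (x : κ → ℤ) = ζbar x := by
    -- two linear maps `Nr → Additive Kˣ` agreeing on the basis `bN`
    suffices h : τ.comp Nr.subtype = ζbar from fun x => by rw [← h]; rfl
    refine snf.bN.ext fun i => ?_
    rw [LinearMap.comp_apply, Submodule.subtype_apply, snf.snf i, map_smul, hτ,
      Module.Basis.constr_basis, hgf, hw]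
  -- the torus element
  refine ⟨fun l => Additive.toMul (τ (Pi.single l 1)), fun v => ?_⟩
  have h1 : ζ (Pi.single v 1) = Additive.ofMul (z v) := by
    rw [hζapply]
    congr 1
    rw [Finset.prod_eq_single v (fun w _ hw => by rw [Pi.single_eq_of_ne hw, zpow_zero])
      (fun h => absurd (Finset.mem_univ v) h), Pi.single_eq_same, zpow_one]
  have h2 : ψ (Pi.single v 1) = ∑ l, A l v • (Pi.single l 1 : κ → ℤ) := by
    ext l
    rw [hψapply, Finset.sum_apply]
    simp only [Pi.smul_apply, Pi.single_apply, smul_eq_mul, mul_ite, mul_one, mul_zero]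
    rw [Finset.sum_ite_eq Finset.univ l, if_pos (Finset.mem_univ _),
      Finset.sum_eq_single v (fun w _ hw => by rw [if_neg hw])
        (fun h => absurd (Finset.mem_univ v) h), if_pos rfl]
  have h3 : ζ (Pi.single v 1) = τ (ψ (Pi.single v 1)) := by
    rw [← hζbar_apply, ← hτN]
  apply_fun Additive.toMul at h3
  rw [h1, toMul_ofMul, h2, map_sum, toMul_sum] at h3
  rw [h3]
  exact Finset.prod_congr rfl fun l _ => by rw [map_smul, toMul_zsmul]

end Summit.ValiantsHypothesis.ValiantsHypothesis.Theorems.GaugeDescent
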